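import Summits.QuantumFields.YangMills.Theorems.BalabanUVNodesN07AtRecordSectGPinned
import Literature.MathematicalPhysics.QuantumFieldTheory.Balaban1983to89.Node00.CarriersZRegPin

/-!
# BalabanUVNodes ∕ N07 ([Balaban1985Variational], `Dag.B11_main`) AT THE FULLY-PINNED-AND-PRESENTED RESIDUAL LAYER
# `ζ⋆ := ((ζ.pinReg ρ g).withSectEG E G).pinCrit` — the regularity data of (9)–(10) PINNED (node00-def-B11 g4's gauge-invariant pin `regPinT`, p478331), «critical»
# PINNED (this lineage's `IsCritOfRecord`, p464601), the Props 2–6 family PRESENTED through Sect. E (node00-def-B11 g2, p462651), the Prop. 9 family PRESENTED through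
# Sect. G (this seat, p477837): every residual slot of `Node00.ResidZ` is now an object of record or a presentation.  What the displayed printed hypotheses of the N07
# closers READ there, as object sentences (kernel `Iff`s); the closers; `t1` READS OBJECTS; print's (9)–(10) without a soundness law; the census in kernel

Track A of `YM-PLAN.md` (cell `pub-ymgap`, HUMAN RULING D-0062), DAG node **N07** = [Balaban1985Variational] T. Bałaban, *The variational problem and background fields in
renormalization group method for lattice gauge theories*, Commun. Math. Phys. **102** (1985) 277–309, Theorem 1 p. 279 and Propositions 2–9 pp. 281–309; node sentence
`Dag.B11_main`, leaf `DagBinding.B11Leaf`.  Seat `pub-ymgap-dag-n07-e` (FAN-OUT v1.1 §N07 row s3), gen 4, tenth module of the lineage; node00-def-B11 g4's hand-over (t2′)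
«the quadruply-refined twin … is n07-e's one-liner» consumed WITHOUT a new definition: the two presentations are taken OVER THE PINNED LAYER `ζ.pinReg ρ g`
(`E : SectEPres F N L η β (ζ.pinReg ρ g)`, `G : SectGPres F N 𝒴 𝒵 (ζ.pinReg ρ g)`; any presentation of `ζ` is one, by def-B11's `SectEPres.pinReg` resp. the anonymous
constructor, the pin leaving the constants unchanged — `fullyPinned_eq_pinReg`).

WHAT (theorems only).
§0 `fullyPinned_faces` — what the four families of ζ⋆ ARE (`rfl` ×4); `fullyPinned_eq_pinReg` — ζ⋆ IS `((ζ.withSectEG E↑ G↑).pinCrit).pinReg ρ g` (`rfl`: all four refinements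
   commute, they replace distinct fields).
§1 ★ WHAT THE DISPLAYED PRINTED HYPOTHESES OF THE N07 CLOSERS READ AT ζ⋆ — OBJECT SENTENCES, NO RESIDUAL DATA (= what a discharge must prove, in kernel form):
   `prop8Printed_famXOfRecord_fullyPinned_iff` (Prop. 8 p. 304 ↔ «a critical-of-record `U ∈ 𝔘_k(ε₀) ∩ 𝔅_k(V)`, `V` with (7) at `ε₁`, `ε₀ ≤ a₅` ⇒ `U ∈ 𝔘_k(B₃ε₁)`»,
   `Iff.rfl`); `prop7Printed_famXOfRecord_fullyPinned_iff` (Prop. 7 p. 299 ↔ «at most one critical-of-record residual orbit in `𝔘_k(ε₀) ∩ 𝔅_k(V)`» ∧ «a minimiser of (5)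
   over `𝔘_k(O₁C₁B₃ε₁) ∩ 𝔅_k(V)` exists», `Iff.rfl`); ★ `sectFPrinted_famXOfRecord_fullyPinned_iff` (Sect. F (169) ⇒ (9)–(10) ↔ «for every critical-of-record
   `U ∈ 𝔘_k(B₃ε₁) ∩ 𝔅_k(V)` and every cube `q` of the class `g i` with `M ≤ RM·a₁∕ε₁`: `GaugedT` ∧ `regConstT < B₃Mε₁` ∧ `ρ·regConstT < B₄Mε₁`» — def-B11's
   `regularity_regPinT_iff` under the binders).
§2 THE CLOSERS AT ζ⋆ (this lineage's p478242 at `ζ := ζ.pinReg ρ g`, by name): `b11Leaf_Z11OfRecord_fullyPinned_of_parts` (print's Prop-7 DAG: p2 p3 p5 ∣ p7 p8 sF),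
   `b11Leaf_Z11OfRecord_fullyPinned_of_towerT_parts_kappa_one` (THE PRINTED TOWER: Props 2, 3, 5 ∣ 8, Sect. F + `βr bg hbg14 gaugeFix orbit16 leaves` + constants; Theorem 1
   and Proposition 7 DERIVED), `exists_record₁₂CB10YZW_b11_main_fullyPinned_of_towerT_parts_kappa_one` (its Stage-12 ∃-consumer, REAL runs modulo K0′),
   `b11_main_at_view₁₂B10YZW_fullyPinned_of_parts` (the composable face for n24-c's MODULE 29 with ζ⋆ CHOSEN), `exists_isRecordOfRecord₁₂C_b11_main_fullyPinned_of_towerT_parts_kappa_one`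
   (the K1′ ∃-form).
§3 ★★ `t1` READS OBJECTS AT ζ⋆: `thm1_objects_fullyPinned_of_towerT_parts_kappa_one` — the tower's displayed inputs + `0 < ρ` + cubes with `sizeM > 0` ⇒ THEOREM 1 AS AN OBJECT SENTENCE:
   constants `C` ON THE RAY `C.B₄ = ρC.B₃`, and for every member, every `0 < ε₁ ≤ a₁`, every `V` with (7): (8) (`Exists8`), uniqueness in (6) (`Unique6`) and print's (9)–(10)
   in the ∃u-form `Reg910T` for every minimal `U` and every cube with `M ≤ M(ε₁)` (def-B11's `thm1Printed_famV_pinReg_iff` ∘ the leaf); `reg910T_fullyPinned_of_towerT_parts_kappa_one`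
   — the (9)–(10) currency with NO soundness law displayed (def-B11's headline `reg910T_of_b11Leaf_pinReg` ∘ the leaf; supersedes this lineage's g3 §E, whose `hs : ζ.RegSound g`
   is gone).
§4 CENSUS IN KERNEL (referee ref-G READ37 (w6) ∕ READ39 REMARK (i), READER RULE v0.38): ★ `sectFPrinted_fullyPinned_of_carrier_empty` — if every cube of every class `g i` has
   EMPTY carrier (and `sizeM > 0`), the displayed hypothesis `sF` HOLDS OUTRIGHT for `B₃ > 0` (def-B11's `regularity_regPinT_of_carrier_empty`): the Sect.-F slot is
   junk-closable THROUGH THE CUBE CLASS, so a COUNT line over ζ⋆ must display non-empty carriers or read `g` from print's cubes («□ ⊂ B_j(Λ_j) ∪ B_{j+1}(Λ_{j+1}) of size 2MLʲη»,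
   p. 279).  What is NOT here, and why: no refutation-style honesty theorem exists at ζ⋆ — `t1`, p7, p8 now READ OBJECTS (their truth is [Balaban1985Variational]'s content,
   Theorem 1 ∕ Props 7–8 at NODE 00's objects, not known to the tree), which is exactly what the four pins are for; what stays free is INSIDE the presentations' data (the
   Sect.-E datum's `Rest` ∕ operators, the Sect.-G datum's geometry ∕ operators — readings declared in p462651 ∕ p477837) and the cube class `g`.
HONEST FRAMING: kernel bookkeeping BY NAME over landed modules; NOTHING of [Balaban1985Variational] proved or asserted; N07 NOT discharged; COUNT-NEUTRAL (5∕27 unmoved); residual for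
a count line BY NAME: the printed statements AT OBJECTS (§1's three sentences + Props 2, 3, 5 over the Sect.-E data = T3-class content), print's cube class for `g`, the operator
data of the two presentations, K0′ (stmt-QuantumFields-19902); one finite T⁴ programme at fixed ε, Bałaban AS PRINTED — NOT continuum ∕ ℝ⁴ ∕ OS ∕ mass-gap ∕ Clay.  No `sorry`,
no `def`, no `instance`, no `notation`.  Filed `--supports stmt-QuantumFields-19903 --as helper` (K1′).
-/

noncomputable section

namespace Summit.QuantumFields.YangMills.BalabanUVNodes.N07AtRecordFullyPinned

open Literature.MathematicalPhysics.QuantumFieldTheory.Balaban1983to89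
open Literature.MathematicalPhysics.QuantumFieldTheory.Balaban1983to89.T4Continuum (T4Family FiniteEpsData)
open Literature.MathematicalPhysics.QuantumFieldTheory.Balaban1983to89.DagBinding
open Literature.MathematicalPhysics.QuantumFieldTheory.Balaban1983to89.Node00
open Literature.MathematicalPhysics.QuantumFieldTheory.Balaban1983to89.B12GaugeOrbits021 (OrbitRel)
open Literature.MathematicalPhysics.QuantumFieldTheory.Balaban1983to89.B11Thm1 (Thm1At Exists8 Unique6)
open Literature.MathematicalPhysics.QuantumFieldTheory.Balaban1983to89.B11Thm1CarrierT (varProblemT)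
open Literature.MathematicalPhysics.QuantumFieldTheory.Balaban1983to89.B11Prop7Assembly (Bridge ExistenceLeavesCap)
open Literature.MathematicalPhysics.QuantumFieldTheory.Balaban1983to89.B11Reg910Classes (Reg910T)
open YMDAG.UVSplit (Datum)
open Summit.QuantumFields.YangMills.BalabanUVNodes.N07AtRecord12 (b11_main_at_view₁₂B10YZW_of_leaf exists_record₁₂CB10YZW_b11_main_of_leaf
  exists_isRecordOfRecord₁₂C_b11_main_of_leaf)
open Summit.QuantumFields.YangMills.BalabanUVNodes.N07AtRecordSectGPinned (b11Leaf_Z11OfRecord_withSectEG_pinCrit_of_parts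
  b11Leaf_Z11OfRecord_withSectEG_pinCrit_of_towerT_parts_kappa_one)
open scoped Matrix.Norms.L2Operator

variable {N : ℕ} [NeZero N] {F : T4Family} {w : WorldP}
variable {L : ℝ} {η : ZIdx → ℝ} [Fact (0 < L)] [∀ i, Fact (0 < η i)] {β : ZIdx → Type} [∀ i, Fintype (β i)]
variable {𝒴 𝒵 : ZIdx → Type} [∀ i, NormedAddCommGroup (𝒴 i)] [∀ i, NormedSpace ℂ (𝒴 i)] [∀ i, CompleteSpace (𝒴 i)]
  [∀ i, NormedAddCommGroup (𝒵 i)] [∀ i, NormedSpace ℂ (𝒵 i)] [∀ i, CompleteSpace (𝒵 i)]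
variable (ζ : ResidZ F N) (ρ : ℝ) (g : ∀ i : ZIdx, RegCubesT F i.K) (E : SectEPres F N L η β (ζ.pinReg ρ g)) (G : SectGPres F N 𝒴 𝒵 (ζ.pinReg ρ g))

/-! ## §0 The layer ζ⋆ and its four families -/

/-- **THE FOUR FAMILIES OF ζ⋆** (`rfl` ×4): the Props 2–6 family is the Sect.-E family of `E`, the Prop. 9 family is the Sect.-G model family of `G`, «critical» is the predicate of
record, and the regularity data of (9)–(10) ARE def-B11's PIN `regPinT F N K k ρ (g i)` — no residual slot of `ResidZ` is free data any more.
[cite: Balaban1985Variational, Props 2–9 pp.281–309, (9)–(10) p.279 (bookkeeping)] -/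
theorem fullyPinned_faces :
    (((ζ.pinReg ρ g).withSectEG E G).pinCrit).famLG = (fun i => (E.D i).toLGData (E.R i) ζ.C₁) ∧
      (((ζ.pinReg ρ g).withSectEG E G).pinCrit).famAn = (fun i => (G.D i).toAnData) ∧
      (∀ i : ZIdx, (((ζ.pinReg ρ g).withSectEG E G).pinCrit).IsCrit i = IsCritOfRecord F N i.K i.k) ∧
      (((ζ.pinReg ρ g).withSectEG E G).pinCrit).R = fun i => regPinT F N i.K i.k ρ (g i) :=
  ⟨rfl, rfl, fun _ => rfl, rfl⟩

/-- **ALL FOUR REFINEMENTS COMMUTE** (`rfl`): ζ⋆ IS def-B11's regularity pin applied LAST to the triply-refined layer of p478242 built from the SAME presentations read over `ζ`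
(the pin leaves every constant unchanged, so `E`, `G` present `ζ` verbatim — def-B11's `SectEPres.pinReg` pattern, anonymous constructors). [cite: Balaban1985Variational, Props 2–9 pp.281–309 (bookkeeping)] -/
theorem fullyPinned_eq_pinReg :
    ((ζ.pinReg ρ g).withSectEG E G).pinCrit =
      ((ζ.withSectEG (⟨E.C₄, E.a₃, E.α, E.D, E.R⟩ : SectEPres F N L η β ζ) (⟨G.q, G.valid, G.hC₁, G.hβ₀, G.hδ₀, G.hB₅, G.D⟩ : SectGPres F N 𝒴 𝒵 ζ)).pinCrit).pinReg ρ g :=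
  rfl

/-! ## §1 What the displayed printed hypotheses of the closers READ at ζ⋆ — object sentences (what a discharge must prove) -/

/-- **PROPOSITION 8 (p. 304) AT ζ⋆ READS AN OBJECT SENTENCE** (`Iff.rfl`): *«if U is a critical configuration of (5) in the space (6) with V satisfying (7), and if ε₀ ≤ a₅, then U
belongs to the space (8)»* — «critical» = this lineage's `IsCritOfRecord` (curve form), (6)∕(8) = n01-b's `InUkClassB11` at radii `ε₀` ∕ `B₃ε₁` with `Ū^k(U) = V`, (7) = `PlaqSmall`.
No residual data: this is WHAT A DISCHARGE OF THE DISPLAYED `p8` MUST PROVE at NODE 00's objects. [cite: Balaban1985Variational, Prop. 8 p.304, (6)–(8) p.278] -/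
theorem prop8Printed_famXOfRecord_fullyPinned_iff (B₃ : ℝ) :
    B11.Prop8Printed B₃ (famXOfRecord F N ((ζ.pinReg ρ g).withSectEG E G).pinCrit) ↔
      ∃ a₅ : ℝ, 0 < a₅ ∧ ∀ (i : ZIdx) (ε₀ ε₁ : ℝ), 0 < ε₁ → ∀ (V : GaugeField (F.P i.K) i.k (SU N)) (U : GaugeField (F.P i.K) 0 (SU N)),
        PlaqSmall ε₁ V → InUkClassB11 F N i.K i.k ε₀ U → Averaging.iter (avOfRecord F N i.K) i.k U = V → IsCritOfRecord F N i.K i.k V U → ε₀ ≤ a₅ →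
          InUkClassB11 F N i.K i.k (B₃ * ε₁) U :=
  Iff.rfl

/-- **PROPOSITION 7 (p. 299) AT ζ⋆ READS AN OBJECT SENTENCE** (`Iff.rfl`): *«for ε₀ ≤ a₀ and B₃ε₁ ≤ ε₀ the variational problem (5), (6) has at most one critical orbit. If ε₁ ≤ a′₁,
then there exists a minimal orbit in the space (6) with ε₀ = O(1)C₁B₃ε₁»* — «one orbit» = the residual gauge orbit `OrbitRel k` (print's group (4), an OBJECT), «critical» =
`IsCritOfRecord`, «minimal orbit» = `IsBackground` over the (2)-class of record (reading D-n07a-2).  No residual data. [cite: Balaban1985Variational, Prop. 7 p.299, (4)–(6) p.278] -/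
theorem prop7Printed_famXOfRecord_fullyPinned_iff (B₃ C₁ : ℝ) :
    B11.Prop7Printed B₃ C₁ (famXOfRecord F N ((ζ.pinReg ρ g).withSectEG E G).pinCrit) ↔
      ∃ a₀ a₁' O₁ : ℝ, 0 < a₀ ∧ 0 < a₁' ∧ 0 < O₁ ∧ ∀ (i : ZIdx) (ε₀ ε₁ : ℝ), 0 < ε₁ → ∀ V : GaugeField (F.P i.K) i.k (SU N), PlaqSmall ε₁ V →
        (ε₀ ≤ a₀ → B₃ * ε₁ ≤ ε₀ → ∀ U U' : GaugeField (F.P i.K) 0 (SU N),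
            InUkClassB11 F N i.K i.k ε₀ U → Averaging.iter (avOfRecord F N i.K) i.k U = V → IsCritOfRecord F N i.K i.k V U →
              InUkClassB11 F N i.K i.k ε₀ U' → Averaging.iter (avOfRecord F N i.K) i.k U' = V → IsCritOfRecord F N i.K i.k V U' → OrbitRel i.k U U') ∧
        (ε₁ ≤ a₁' → ∃ U : GaugeField (F.P i.K) 0 (SU N),
            IsBackground (avOfRecord F N i.K) {U | InUkClassB11 F N i.K i.k (O₁ * C₁ * B₃ * ε₁) U} i.k V U) :=
  Iff.rfl

/-- ★ **SECT. F's CONCLUSION (169) ⇒ (9)–(10) (p. 305) AT ζ⋆ READS AN OBJECT SENTENCE**: *«… hence we have proved the regularity conditions (9), (10)»* for every critical configuration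
in (8) and every cube of size `2MLʲη`, `M ≤ R₁M₁(a₁∕ε₁)` — at the pin the typed `B11.Regularity` of each cube IS «`(U, □)` is gauged in print's ∃u-sense and its OPTIMAL REGULARITY
CONSTANT lies below `B₃Mε₁` and below `B₄Mε₁∕ρ`» (def-B11 g4's `regularity_regPinT_iff`, the Hölder clause one inequality on the ray).  The cube class `g` (print's «□ ⊂ B_j(Λ_j) ∪
B_{j+1}(Λ_{j+1})», p. 279) is the one residual DATUM this sentence reads. [cite: Balaban1985Variational, Sect. F (169) p.305, Thm 1 (9)–(10) p.279] -/
theorem sectFPrinted_famXOfRecord_fullyPinned_iff (B₃ : ℝ) :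
    B11.SectFPrinted B₃ (famXOfRecord F N ((ζ.pinReg ρ g).withSectEG E G).pinCrit) ↔
      ∃ a₁ B₄ RM : ℝ, 0 < a₁ ∧ 0 < B₄ ∧ 0 < RM ∧
        ∀ (i : ZIdx) (ε₁ : ℝ) (V : GaugeField (F.P i.K) i.k (SU N)) (U : GaugeField (F.P i.K) 0 (SU N)), 0 < ε₁ → ε₁ ≤ a₁ → PlaqSmall ε₁ V →
          InUkClassB11 F N i.K i.k (B₃ * ε₁) U → Averaging.iter (avOfRecord F N i.K) i.k U = V → IsCritOfRecord F N i.K i.k V U →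
            ∀ q : (g i).Q, (g i).sizeM q ≤ RM * (a₁ / ε₁) →
              GaugedT F N i.K i.k ρ (g i) U q ∧ regConstT F N i.K i.k ρ (g i) U q < B₃ * (g i).sizeM q * ε₁ ∧
                ρ * regConstT F N i.K i.k ρ (g i) U q < B₄ * (g i).sizeM q * ε₁ :=
  exists_congr fun _ => exists_congr fun _ => exists_congr fun _ => and_congr Iff.rfl <| and_congr Iff.rfl <| and_congr Iff.rfl <|
    forall_congr' fun _ => forall_congr' fun _ => forall_congr' fun _ => forall_congr' fun _ => forall_congr' fun _ => forall_congr' fun _ =>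
      forall_congr' fun _ => forall_congr' fun _ => forall_congr' fun _ => forall_congr' fun _ => forall_congr' fun _ => forall_congr' fun _ =>
        regularity_regPinT_iff

/-! ## §2 The closers at ζ⋆ (this lineage's triply-refined closers at the pinned layer, by name) -/

/-- **THE [B11] LEAF AT `Z11OfRecord F N ζ⋆` FROM SIX PRINTED STATEMENTS, print's Prop-7 DAG** — Props 2, 3, 5 over the Sect.-E family, Props 7, 8, Sect. F over the fully-pinned Props 7–8
family (§1: object sentences + the cube class) — and the letters' positivity; p4∕p6∕p9∕`hcrit` theorems, `hloc` absent (p478242's `b11Leaf_Z11OfRecord_withSectEG_pinCrit_of_parts` at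
`ζ.pinReg ρ g`). [cite: Balaban1985Variational, Thm 1 p.279, Props 2–9 pp.281–309] -/
theorem b11Leaf_Z11OfRecord_fullyPinned_of_parts (hC₄ : 0 < E.C₄) (ha₃ : 0 < E.a₃) (hα : 0 < E.α) (hB₀ : 0 < ζ.B₀) (hB₃ : 0 < ζ.B₃) (hC₁ : 0 < ζ.C₁)
    (p2 : B11.Prop2Printed ζ.B₁ ζ.B₃ ζ.C₁ ζ.c₁ ((ζ.pinReg ρ g).withSectE E).famLG)
    (p3 : B11.Prop3Printed ζ.C₁ ζ.B₃ ζ.C₂ ζ.C₃ ζ.B₀ ζ.c1h ζ.c₄ ζ.δ₀ ((ζ.pinReg ρ g).withSectE E).famLG)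
    (p5 : B11.Prop5Printed ζ.B₁ ζ.B₃ ζ.C₁ ((ζ.pinReg ρ g).withSectE E).famLG)
    (p7 : B11.Prop7Printed ζ.B₃ ζ.C₁ (famXOfRecord F N ((ζ.pinReg ρ g).withSectEG E G).pinCrit))
    (p8 : B11.Prop8Printed ζ.B₃ (famXOfRecord F N ((ζ.pinReg ρ g).withSectEG E G).pinCrit))
    (sF : B11.SectFPrinted ζ.B₃ (famXOfRecord F N ((ζ.pinReg ρ g).withSectEG E G).pinCrit)) :
    B11Leaf (Z11OfRecord F N ((ζ.pinReg ρ g).withSectEG E G).pinCrit) :=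
  b11Leaf_Z11OfRecord_withSectEG_pinCrit_of_parts (ζ.pinReg ρ g) E G hC₄ ha₃ hα hB₀ hB₃ hC₁ p2 p3 p5 p7 p8 sF

/-- ★ **THE PRINTED TOWER (κ₀ = 1) AT ζ⋆ — THE [B11] LEAF FROM PROPS 2, 3, 5, 8, SECT. F, THE BRIDGE DATA WITH ITS TWO PRINTED CLAUSES, THE CAPPED EXISTENCE LEAVES AND THE CONSTANT
RELATIONS; NOTHING ELSE**: Theorem 1 AND Proposition 7 DERIVED (the repaired Sect.-A induction of record), p4∕p6∕p9∕`hcrit` theorems, `hloc` absent, the bridge laws' `symm`∕`trans`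
theorems; every displayed statement about the Props 7–8 family reads OBJECTS (§1).  p478242's tower closer at `ζ.pinReg ρ g`. [cite: Balaban1985Variational, Thm 1 p.279, Sect. A (11)–(18) pp.279–280, Props 2–9 pp.281–309] -/
theorem b11Leaf_Z11OfRecord_fullyPinned_of_towerT_parts_kappa_one (hC₄ : 0 < E.C₄) (ha₃ : 0 < E.a₃) (hα : 0 < E.α)
    (βr : ∀ i : ZIdx, Bridge (famXOfRecord F N ((ζ.pinReg ρ g).withSectEG E G).pinCrit i) (((ζ.pinReg ρ g).withSectE E).famLG i))
    (bg : ∀ i : ZIdx, GaugeField (F.P i.K) 0 (SU N) → (((ζ.pinReg ρ g).withSectE E).famLG i).Cfg) {O₁ O₂ e₅ : ℝ}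
    (hbg14 : ∀ (i : ZIdx) (ε : ℝ) (V : GaugeField (F.P i.K) i.k (SU N)) (U : GaugeField (F.P i.K) 0 (SU N)),
      InUkClassB11 F N i.K i.k (ζ.C₁ * ζ.B₃ * ε) U → Averaging.iter (avOfRecord F N i.K) i.k U = V →
        (((ζ.pinReg ρ g).withSectE E).famLG i).Sat14 (ζ.C₁ * ζ.B₃ * ε) (ζ.C₁ * ε) ((βr i).bdry V) (bg i U))
    (gaugeFix : ∀ (i : ZIdx) (ε₀ ε₁ : ℝ) (V : GaugeField (F.P i.K) i.k (SU N)) (U₀ : (((ζ.pinReg ρ g).withSectE E).famLG i).Cfg)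
      (U : GaugeField (F.P i.K) 0 (SU N)),
      (((ζ.pinReg ρ g).withSectE E).famLG i).Sat14 (ζ.C₁ * ζ.B₃ * ε₁) (ζ.C₁ * ε₁) ((βr i).bdry V) U₀ → InUkClassB11 F N i.K i.k ε₀ U →
        Averaging.iter (avOfRecord F N i.K) i.k U = V →
          ∃ U' : (((ζ.pinReg ρ g).withSectE E).famLG i).Pert, (((ζ.pinReg ρ g).withSectE E).famLG i).In18 ε₀ ((βr i).bdry V) U₀ U' ∧
            OrbitRel i.k U ((βr i).emb U₀ U') ∧ (IsCritOfRecord F N i.K i.k V U → (((ζ.pinReg ρ g).withSectE E).famLG i).Crit ((βr i).bdry V) U₀ U'))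
    (orbit16 : ∀ (i : ZIdx) (U₀ : (((ζ.pinReg ρ g).withSectE E).famLG i).Cfg) (U₁ : (((ζ.pinReg ρ g).withSectE E).famLG i).Pert)
      (u u' : (((ζ.pinReg ρ g).withSectE E).famLG i).GT),
      (((ζ.pinReg ρ g).withSectE E).famLG i).Restricted U₀ u → (((ζ.pinReg ρ g).withSectE E).famLG i).Restricted U₀ u' →
        OrbitRel i.k ((βr i).emb U₀ ((((ζ.pinReg ρ g).withSectE E).famLG i).toAxial U₀ U₁ u))
          ((βr i).emb U₀ ((((ζ.pinReg ρ g).withSectE E).famLG i).toAxial U₀ U₁ u')))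
    (leaves : ∀ i, ExistenceLeavesCap (βr i) ζ.B₀ ζ.B₃ ζ.C₁ O₁ O₂ e₅)
    (hB₀ : 0 < ζ.B₀) (hB₁ : 0 < ζ.B₁) (hB₃ : 1 ≤ ζ.B₃) (hC₁L : (F.L : ℝ) ^ 3 ≤ ζ.C₁) (hB₀B₁ : ζ.B₀ ≤ 4 * ζ.B₁)
    (hc₁ : 0 < ζ.c₁) (hO₁ : 0 < O₁) (hO₂ : 0 < O₂) (he₅ : 0 < e₅)
    (p2 : B11.Prop2Printed ζ.B₁ ζ.B₃ ζ.C₁ ζ.c₁ ((ζ.pinReg ρ g).withSectE E).famLG)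
    (p3 : B11.Prop3Printed ζ.C₁ ζ.B₃ ζ.C₂ ζ.C₃ ζ.B₀ ζ.c1h ζ.c₄ ζ.δ₀ ((ζ.pinReg ρ g).withSectE E).famLG)
    (p5 : B11.Prop5Printed ζ.B₁ ζ.B₃ ζ.C₁ ((ζ.pinReg ρ g).withSectE E).famLG)
    (p8 : B11.Prop8Printed ζ.B₃ (famXOfRecord F N ((ζ.pinReg ρ g).withSectEG E G).pinCrit))
    (sF : B11.SectFPrinted ζ.B₃ (famXOfRecord F N ((ζ.pinReg ρ g).withSectEG E G).pinCrit)) :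
    B11Leaf (Z11OfRecord F N ((ζ.pinReg ρ g).withSectEG E G).pinCrit) :=
  b11Leaf_Z11OfRecord_withSectEG_pinCrit_of_towerT_parts_kappa_one (ζ.pinReg ρ g) E G hC₄ ha₃ hα βr bg hbg14 gaugeFix orbit16 leaves hB₀ hB₁ hB₃ hC₁L
    hB₀B₁ hc₁ hO₁ hO₂ he₅ p2 p3 p5 p8 sF

/-- **… ITS STAGE-12 CONSUMER**: the tower's displayed inputs at ζ⋆ ⇒ N07 HOLDS at every run of a ₁₂CB10YZW record over `datumOfRecord₁₂ θ h` presented with ζ⋆ — THE N07 NODE SENTENCE OF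
RECORD IN THE s3 CURRENCY AT THE FULLY-PINNED LAYER (REAL Stage-12 runs modulo K0′; junk in-edges at the presenting world; NOT a discharge).
[cite: Balaban1985Variational, Thm 1 p.279, Sect. A (11)–(18) pp.279–280, Props 2–9 pp.281–309] -/
theorem exists_record₁₂CB10YZW_b11_main_fullyPinned_of_towerT_parts_kappa_one (θ : Stage12Params F N) (h : θ.Provisos₁₂ F N) (hθ : θ.Admissible F N)
    (hγ : 0 < θ.γ) (Mstar : ℕ) (ops : OpsY N θ.toStage3Params Mstar) (lamW : ResidW F N) (hC₄ : 0 < E.C₄) (ha₃ : 0 < E.a₃) (hα : 0 < E.α)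
    (βr : ∀ i : ZIdx, Bridge (famXOfRecord F N ((ζ.pinReg ρ g).withSectEG E G).pinCrit i) (((ζ.pinReg ρ g).withSectE E).famLG i))
    (bg : ∀ i : ZIdx, GaugeField (F.P i.K) 0 (SU N) → (((ζ.pinReg ρ g).withSectE E).famLG i).Cfg) {O₁ O₂ e₅ : ℝ}
    (hbg14 : ∀ (i : ZIdx) (ε : ℝ) (V : GaugeField (F.P i.K) i.k (SU N)) (U : GaugeField (F.P i.K) 0 (SU N)),
      InUkClassB11 F N i.K i.k (ζ.C₁ * ζ.B₃ * ε) U → Averaging.iter (avOfRecord F N i.K) i.k U = V →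
        (((ζ.pinReg ρ g).withSectE E).famLG i).Sat14 (ζ.C₁ * ζ.B₃ * ε) (ζ.C₁ * ε) ((βr i).bdry V) (bg i U))
    (gaugeFix : ∀ (i : ZIdx) (ε₀ ε₁ : ℝ) (V : GaugeField (F.P i.K) i.k (SU N)) (U₀ : (((ζ.pinReg ρ g).withSectE E).famLG i).Cfg)
      (U : GaugeField (F.P i.K) 0 (SU N)),
      (((ζ.pinReg ρ g).withSectE E).famLG i).Sat14 (ζ.C₁ * ζ.B₃ * ε₁) (ζ.C₁ * ε₁) ((βr i).bdry V) U₀ → InUkClassB11 F N i.K i.k ε₀ U →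
        Averaging.iter (avOfRecord F N i.K) i.k U = V →
          ∃ U' : (((ζ.pinReg ρ g).withSectE E).famLG i).Pert, (((ζ.pinReg ρ g).withSectE E).famLG i).In18 ε₀ ((βr i).bdry V) U₀ U' ∧
            OrbitRel i.k U ((βr i).emb U₀ U') ∧ (IsCritOfRecord F N i.K i.k V U → (((ζ.pinReg ρ g).withSectE E).famLG i).Crit ((βr i).bdry V) U₀ U'))
    (orbit16 : ∀ (i : ZIdx) (U₀ : (((ζ.pinReg ρ g).withSectE E).famLG i).Cfg) (U₁ : (((ζ.pinReg ρ g).withSectE E).famLG i).Pert)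
      (u u' : (((ζ.pinReg ρ g).withSectE E).famLG i).GT),
      (((ζ.pinReg ρ g).withSectE E).famLG i).Restricted U₀ u → (((ζ.pinReg ρ g).withSectE E).famLG i).Restricted U₀ u' →
        OrbitRel i.k ((βr i).emb U₀ ((((ζ.pinReg ρ g).withSectE E).famLG i).toAxial U₀ U₁ u))
          ((βr i).emb U₀ ((((ζ.pinReg ρ g).withSectE E).famLG i).toAxial U₀ U₁ u')))
    (leaves : ∀ i, ExistenceLeavesCap (βr i) ζ.B₀ ζ.B₃ ζ.C₁ O₁ O₂ e₅)
    (hB₀ : 0 < ζ.B₀) (hB₁ : 0 < ζ.B₁) (hB₃ : 1 ≤ ζ.B₃) (hC₁L : (F.L : ℝ) ^ 3 ≤ ζ.C₁) (hB₀B₁ : ζ.B₀ ≤ 4 * ζ.B₁)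
    (hc₁ : 0 < ζ.c₁) (hO₁ : 0 < O₁) (hO₂ : 0 < O₂) (he₅ : 0 < e₅)
    (p2 : B11.Prop2Printed ζ.B₁ ζ.B₃ ζ.C₁ ζ.c₁ ((ζ.pinReg ρ g).withSectE E).famLG)
    (p3 : B11.Prop3Printed ζ.C₁ ζ.B₃ ζ.C₂ ζ.C₃ ζ.B₀ ζ.c1h ζ.c₄ ζ.δ₀ ((ζ.pinReg ρ g).withSectE E).famLG)
    (p5 : B11.Prop5Printed ζ.B₁ ζ.B₃ ζ.C₁ ((ζ.pinReg ρ g).withSectE E).famLG)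
    (p8 : B11.Prop8Printed ζ.B₃ (famXOfRecord F N ((ζ.pinReg ρ g).withSectEG E G).pinCrit))
    (sF : B11.SectFPrinted ζ.B₃ (famXOfRecord F N ((ζ.pinReg ρ g).withSectEG E G).pinCrit)) :
    ∃ w : WorldP, IsRecordOfRecord₁₂CB10YZW F N (datumOfRecord₁₂ F N θ h) w ∧ ∀ P : B12.RunParams, Dag.B11_main (leavesP w P) :=
  exists_record₁₂CB10YZW_b11_main_of_leaf θ h hθ hγ Mstar ops _ lamW
    (b11Leaf_Z11OfRecord_fullyPinned_of_towerT_parts_kappa_one ζ ρ g E G hC₄ ha₃ hα βr bg hbg14 gaugeFix orbit16 leaves hB₀ hB₁ hB₃ hC₁L hB₀B₁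
      hc₁ hO₁ hO₂ he₅ p2 p3 p5 p8 sF)

/-- **THE COMPOSABLE FACE FOR THE K1′ KNIT, ζ⋆ CHOSEN**: for ANY world bound to the four-pin Stage-12 view presenting ζ⋆ as its [B11] layer, the six printed statements of the DAG currency give
`Dag.B11_main` at every run — n24-c's MODULE 29 recipe with the regularity-pinned, crit-pinned, doubly-presented layer chosen. [cite: Balaban1985Variational, Thm 1 p.279, Props 2–9 pp.281–309 (bookkeeping: the node at the four-pin view)] -/
theorem b11_main_at_view₁₂B10YZW_fullyPinned_of_parts (θ : Stage12Params F N) (Mstar : ℕ) (ops : OpsY N θ.toStage3Params Mstar) (lamW : ResidW F N)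
    (hup : ∀ P, w.up P = upOfRecord₅C F N (θ.view₁₂B10YZW F N Mstar ops (((ζ.pinReg ρ g).withSectEG E G).pinCrit) lamW) P)
    (hC₄ : 0 < E.C₄) (ha₃ : 0 < E.a₃) (hα : 0 < E.α) (hB₀ : 0 < ζ.B₀) (hB₃ : 0 < ζ.B₃) (hC₁ : 0 < ζ.C₁)
    (p2 : B11.Prop2Printed ζ.B₁ ζ.B₃ ζ.C₁ ζ.c₁ ((ζ.pinReg ρ g).withSectE E).famLG)
    (p3 : B11.Prop3Printed ζ.C₁ ζ.B₃ ζ.C₂ ζ.C₃ ζ.B₀ ζ.c1h ζ.c₄ ζ.δ₀ ((ζ.pinReg ρ g).withSectE E).famLG)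
    (p5 : B11.Prop5Printed ζ.B₁ ζ.B₃ ζ.C₁ ((ζ.pinReg ρ g).withSectE E).famLG)
    (p7 : B11.Prop7Printed ζ.B₃ ζ.C₁ (famXOfRecord F N ((ζ.pinReg ρ g).withSectEG E G).pinCrit))
    (p8 : B11.Prop8Printed ζ.B₃ (famXOfRecord F N ((ζ.pinReg ρ g).withSectEG E G).pinCrit))
    (sF : B11.SectFPrinted ζ.B₃ (famXOfRecord F N ((ζ.pinReg ρ g).withSectEG E G).pinCrit)) (P : B12.RunParams) :
    Dag.B11_main (leavesP w P) :=
  b11_main_at_view₁₂B10YZW_of_leaf θ Mstar ops _ lamW hup (b11Leaf_Z11OfRecord_fullyPinned_of_parts ζ ρ g E G hC₄ ha₃ hα hB₀ hB₃ hC₁ p2 p3 p5 p7 p8 sF) P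

omit [NeZero N] in
/-- **THE K1′ ∃-FORM IN THE TOWER CURRENCY AT ζ⋆**: K0′ at `F` (HYPOTHESIS) + the tower's displayed inputs ⇒ SOME ₁₂C record of the given datum, its world re-bound by the four-pin view presenting
ζ⋆, is a ₁₂CB10YZW record carrying `Dag.B11_main` at every run.  N07 ALONE; NOT a discharge. [cite: Balaban1985Variational, Thm 1 p.279, Sect. A pp.279–280, Props 2–9 pp.281–309; Balaban1989LargeFieldII, Thm 1 + (0.1) pp.355–356 (bookkeeping)] -/
theorem exists_isRecordOfRecord₁₂C_b11_main_fullyPinned_of_towerT_parts_kappa_one [NeZero N]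
    (hK0 : ∃ (D : Datum F N) (w : WorldP), IsRecordOfRecord₁₂C F N D w) (hC₄ : 0 < E.C₄) (ha₃ : 0 < E.a₃) (hα : 0 < E.α)
    (βr : ∀ i : ZIdx, Bridge (famXOfRecord F N ((ζ.pinReg ρ g).withSectEG E G).pinCrit i) (((ζ.pinReg ρ g).withSectE E).famLG i))
    (bg : ∀ i : ZIdx, GaugeField (F.P i.K) 0 (SU N) → (((ζ.pinReg ρ g).withSectE E).famLG i).Cfg) {O₁ O₂ e₅ : ℝ}
    (hbg14 : ∀ (i : ZIdx) (ε : ℝ) (V : GaugeField (F.P i.K) i.k (SU N)) (U : GaugeField (F.P i.K) 0 (SU N)),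
      InUkClassB11 F N i.K i.k (ζ.C₁ * ζ.B₃ * ε) U → Averaging.iter (avOfRecord F N i.K) i.k U = V →
        (((ζ.pinReg ρ g).withSectE E).famLG i).Sat14 (ζ.C₁ * ζ.B₃ * ε) (ζ.C₁ * ε) ((βr i).bdry V) (bg i U))
    (gaugeFix : ∀ (i : ZIdx) (ε₀ ε₁ : ℝ) (V : GaugeField (F.P i.K) i.k (SU N)) (U₀ : (((ζ.pinReg ρ g).withSectE E).famLG i).Cfg)
      (U : GaugeField (F.P i.K) 0 (SU N)),
      (((ζ.pinReg ρ g).withSectE E).famLG i).Sat14 (ζ.C₁ * ζ.B₃ * ε₁) (ζ.C₁ * ε₁) ((βr i).bdry V) U₀ → InUkClassB11 F N i.K i.k ε₀ U →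
        Averaging.iter (avOfRecord F N i.K) i.k U = V →
          ∃ U' : (((ζ.pinReg ρ g).withSectE E).famLG i).Pert, (((ζ.pinReg ρ g).withSectE E).famLG i).In18 ε₀ ((βr i).bdry V) U₀ U' ∧
            OrbitRel i.k U ((βr i).emb U₀ U') ∧ (IsCritOfRecord F N i.K i.k V U → (((ζ.pinReg ρ g).withSectE E).famLG i).Crit ((βr i).bdry V) U₀ U'))
    (orbit16 : ∀ (i : ZIdx) (U₀ : (((ζ.pinReg ρ g).withSectE E).famLG i).Cfg) (U₁ : (((ζ.pinReg ρ g).withSectE E).famLG i).Pert)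
      (u u' : (((ζ.pinReg ρ g).withSectE E).famLG i).GT),
      (((ζ.pinReg ρ g).withSectE E).famLG i).Restricted U₀ u → (((ζ.pinReg ρ g).withSectE E).famLG i).Restricted U₀ u' →
        OrbitRel i.k ((βr i).emb U₀ ((((ζ.pinReg ρ g).withSectE E).famLG i).toAxial U₀ U₁ u))
          ((βr i).emb U₀ ((((ζ.pinReg ρ g).withSectE E).famLG i).toAxial U₀ U₁ u')))
    (leaves : ∀ i, ExistenceLeavesCap (βr i) ζ.B₀ ζ.B₃ ζ.C₁ O₁ O₂ e₅)
    (hB₀ : 0 < ζ.B₀) (hB₁ : 0 < ζ.B₁) (hB₃ : 1 ≤ ζ.B₃) (hC₁L : (F.L : ℝ) ^ 3 ≤ ζ.C₁) (hB₀B₁ : ζ.B₀ ≤ 4 * ζ.B₁)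
    (hc₁ : 0 < ζ.c₁) (hO₁ : 0 < O₁) (hO₂ : 0 < O₂) (he₅ : 0 < e₅)
    (p2 : B11.Prop2Printed ζ.B₁ ζ.B₃ ζ.C₁ ζ.c₁ ((ζ.pinReg ρ g).withSectE E).famLG)
    (p3 : B11.Prop3Printed ζ.C₁ ζ.B₃ ζ.C₂ ζ.C₃ ζ.B₀ ζ.c1h ζ.c₄ ζ.δ₀ ((ζ.pinReg ρ g).withSectE E).famLG)
    (p5 : B11.Prop5Printed ζ.B₁ ζ.B₃ ζ.C₁ ((ζ.pinReg ρ g).withSectE E).famLG)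
    (p8 : B11.Prop8Printed ζ.B₃ (famXOfRecord F N ((ζ.pinReg ρ g).withSectEG E G).pinCrit))
    (sF : B11.SectFPrinted ζ.B₃ (famXOfRecord F N ((ζ.pinReg ρ g).withSectEG E G).pinCrit)) :
    ∃ (D : Datum F N) (w : WorldP), IsRecordOfRecord₁₂C F N D w ∧ IsRecordOfRecord₁₂CB10YZW F N D w ∧ ∀ P : B12.RunParams, Dag.B11_main (leavesP w P) :=
  exists_isRecordOfRecord₁₂C_b11_main_of_leaf F hK0 _
    (b11Leaf_Z11OfRecord_fullyPinned_of_towerT_parts_kappa_one ζ ρ g E G hC₄ ha₃ hα βr bg hbg14 gaugeFix orbit16 leaves hB₀ hB₁ hB₃ hC₁L hB₀B₁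
      hc₁ hO₁ hO₂ he₅ p2 p3 p5 p8 sF)

/-! ## §3 At ζ⋆ the leaf's Theorem-1 conjunct READS OBJECTS; print's (9)–(10) without a soundness law -/

/-- ★★ **THEOREM 1 AS AN OBJECT SENTENCE FROM THE TOWER's DISPLAYED INPUTS** (cube classes with `sizeM > 0`, ratio `ρ > 0`): constants `C` ON THE RAY `C.B₄ = ρ·C.B₃`, and for every member
`i = ⟨K, k, _⟩`, every `0 < ε₁ ≤ a₁`, every `V` with (7): (8) — a minimiser of (5) over `𝔘_k(B₃ε₁) ∩ 𝔅_k(V)` EXISTS (`Exists8`, n07-a's `exists8_iff`); uniqueness in (6) modulo the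
residual gauge group (`Unique6`); and print's (9)–(10) in the ∃u-form `Reg910T` for every minimal `U` and every cube with `M ≤ M(ε₁)` — the leaf's `t1` passed through def-B11 g4's
`thm1Printed_famV_pinReg_iff` (`⇒`: move the block of constants onto the ray).  At ζ⋆ the ∀-form junk channel through the regularity data (`CarriersZ.exists_residZ_not_b11Leaf`,
this lineage's census theorems up to p478242) is CLOSED. [cite: Balaban1985Variational, Thm 1 pp.278–279, (8)–(10)] -/
theorem thm1_objects_fullyPinned_of_towerT_parts_kappa_one (hρ : 0 < ρ) (hM : ∀ (i : ZIdx) (q : (g i).Q), 0 < (g i).sizeM q)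
    (hC₄ : 0 < E.C₄) (ha₃ : 0 < E.a₃) (hα : 0 < E.α)
    (βr : ∀ i : ZIdx, Bridge (famXOfRecord F N ((ζ.pinReg ρ g).withSectEG E G).pinCrit i) (((ζ.pinReg ρ g).withSectE E).famLG i))
    (bg : ∀ i : ZIdx, GaugeField (F.P i.K) 0 (SU N) → (((ζ.pinReg ρ g).withSectE E).famLG i).Cfg) {O₁ O₂ e₅ : ℝ}
    (hbg14 : ∀ (i : ZIdx) (ε : ℝ) (V : GaugeField (F.P i.K) i.k (SU N)) (U : GaugeField (F.P i.K) 0 (SU N)),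
      InUkClassB11 F N i.K i.k (ζ.C₁ * ζ.B₃ * ε) U → Averaging.iter (avOfRecord F N i.K) i.k U = V →
        (((ζ.pinReg ρ g).withSectE E).famLG i).Sat14 (ζ.C₁ * ζ.B₃ * ε) (ζ.C₁ * ε) ((βr i).bdry V) (bg i U))
    (gaugeFix : ∀ (i : ZIdx) (ε₀ ε₁ : ℝ) (V : GaugeField (F.P i.K) i.k (SU N)) (U₀ : (((ζ.pinReg ρ g).withSectE E).famLG i).Cfg)
      (U : GaugeField (F.P i.K) 0 (SU N)),
      (((ζ.pinReg ρ g).withSectE E).famLG i).Sat14 (ζ.C₁ * ζ.B₃ * ε₁) (ζ.C₁ * ε₁) ((βr i).bdry V) U₀ → InUkClassB11 F N i.K i.k ε₀ U →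
        Averaging.iter (avOfRecord F N i.K) i.k U = V →
          ∃ U' : (((ζ.pinReg ρ g).withSectE E).famLG i).Pert, (((ζ.pinReg ρ g).withSectE E).famLG i).In18 ε₀ ((βr i).bdry V) U₀ U' ∧
            OrbitRel i.k U ((βr i).emb U₀ U') ∧ (IsCritOfRecord F N i.K i.k V U → (((ζ.pinReg ρ g).withSectE E).famLG i).Crit ((βr i).bdry V) U₀ U'))
    (orbit16 : ∀ (i : ZIdx) (U₀ : (((ζ.pinReg ρ g).withSectE E).famLG i).Cfg) (U₁ : (((ζ.pinReg ρ g).withSectE E).famLG i).Pert)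
      (u u' : (((ζ.pinReg ρ g).withSectE E).famLG i).GT),
      (((ζ.pinReg ρ g).withSectE E).famLG i).Restricted U₀ u → (((ζ.pinReg ρ g).withSectE E).famLG i).Restricted U₀ u' →
        OrbitRel i.k ((βr i).emb U₀ ((((ζ.pinReg ρ g).withSectE E).famLG i).toAxial U₀ U₁ u))
          ((βr i).emb U₀ ((((ζ.pinReg ρ g).withSectE E).famLG i).toAxial U₀ U₁ u')))
    (leaves : ∀ i, ExistenceLeavesCap (βr i) ζ.B₀ ζ.B₃ ζ.C₁ O₁ O₂ e₅)
    (hB₀ : 0 < ζ.B₀) (hB₁ : 0 < ζ.B₁) (hB₃ : 1 ≤ ζ.B₃) (hC₁L : (F.L : ℝ) ^ 3 ≤ ζ.C₁) (hB₀B₁ : ζ.B₀ ≤ 4 * ζ.B₁)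
    (hc₁ : 0 < ζ.c₁) (hO₁ : 0 < O₁) (hO₂ : 0 < O₂) (he₅ : 0 < e₅)
    (p2 : B11.Prop2Printed ζ.B₁ ζ.B₃ ζ.C₁ ζ.c₁ ((ζ.pinReg ρ g).withSectE E).famLG)
    (p3 : B11.Prop3Printed ζ.C₁ ζ.B₃ ζ.C₂ ζ.C₃ ζ.B₀ ζ.c1h ζ.c₄ ζ.δ₀ ((ζ.pinReg ρ g).withSectE E).famLG)
    (p5 : B11.Prop5Printed ζ.B₁ ζ.B₃ ζ.C₁ ((ζ.pinReg ρ g).withSectE E).famLG)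
    (p8 : B11.Prop8Printed ζ.B₃ (famXOfRecord F N ((ζ.pinReg ρ g).withSectEG E G).pinCrit))
    (sF : B11.SectFPrinted ζ.B₃ (famXOfRecord F N ((ζ.pinReg ρ g).withSectEG E G).pinCrit)) :
    ∃ C : B11Thm1.Consts, C.B₄ = ρ * C.B₃ ∧ ∀ (i : ZIdx) (ε₁ : ℝ), 0 < ε₁ → ε₁ ≤ C.a₁ →
      ∀ V : GaugeField (F.P i.K) i.k (SU N), PlaqSmall ε₁ V →
        Exists8 (varProblemT F N i.K i.k (regPinT F N i.K i.k ρ (g i))) C.B₃ ε₁ V ∧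
        Unique6 (varProblemT F N i.K i.k (regPinT F N i.K i.k ρ (g i))) C.a₀ C.B₃ ε₁ V ∧
        ∀ U : GaugeField (F.P i.K) 0 (SU N), IsBackground (avOfRecord F N i.K) {U | InUkClassB11 F N i.K i.k (C.B₃ * ε₁) U} i.k V U →
          ∀ q : (g i).Q, (g i).sizeM q ≤ C.Mfun ε₁ →
            Reg910T F N i.K i.k U ((g i).carrier q) ((g i).scale q) (g i).dist (C.B₃ * (g i).sizeM q * ε₁) (C.B₄ * (g i).sizeM q * ε₁) 1 := by
  have hleaf := b11Leaf_Z11OfRecord_fullyPinned_of_towerT_parts_kappa_one ζ ρ g E G hC₄ ha₃ hα βr bg hbg14 gaugeFix orbit16 leaves hB₀ hB₁ hB₃ hC₁L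
    hB₀B₁ hc₁ hO₁ hO₂ he₅ p2 p3 p5 p8 sF
  have ht1 : B11.Thm1Printed (famVOfRecord F N
      (((ζ.withSectEG (⟨E.C₄, E.a₃, E.α, E.D, E.R⟩ : SectEPres F N L η β ζ) (⟨G.q, G.valid, G.hC₁, G.hβ₀, G.hδ₀, G.hB₅, G.D⟩ : SectGPres F N 𝒴 𝒵 ζ)).pinCrit).pinReg ρ g)) :=
    hleaf.t1
  exact (thm1Printed_famV_pinReg_iff hρ hM).1 ht1

/-- **PRINT's (9)–(10) FROM THE TOWER's DISPLAYED INPUTS, NO SOUNDNESS LAW** (`ρ > 0`): for every member, every `0 < ε₁ ≤ a₁`, every `V` with (7), every minimal `U` of (5) over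
`𝔘_k(B₃ε₁) ∩ 𝔅_k(V)` and every cube `q` of the class `g i` with `M ≤ M(ε₁)`: a gauge `u` of unitary type on `□ = (g i).carrier q` with `Uᵘ = e^{iηA}` and `|A| < B₃Mε₁ξ⁻¹`,
`|∇^ηA| < B₃Mε₁ξ⁻²`, Hölder `< B₄Mε₁ξ^{−(2+β)}`, `|∂^{η*}∂^ηA|, |Δ^ηA| < B₃Mε₁ξ⁻³` (`Reg910T`) — def-B11 g4's headline `reg910T_of_b11Leaf_pinReg` ∘ the leaf; this lineage's g3 §E with
the displayed `hs : ζ.RegSound g` GONE.  Census (ref-G (w6)): at an empty carrier the conclusion is vacuous. [cite: Balaban1985Variational, Thm 1 pp.278–279, (9)–(10)] -/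
theorem reg910T_fullyPinned_of_towerT_parts_kappa_one (hρ : 0 < ρ) (hC₄ : 0 < E.C₄) (ha₃ : 0 < E.a₃) (hα : 0 < E.α)
    (βr : ∀ i : ZIdx, Bridge (famXOfRecord F N ((ζ.pinReg ρ g).withSectEG E G).pinCrit i) (((ζ.pinReg ρ g).withSectE E).famLG i))
    (bg : ∀ i : ZIdx, GaugeField (F.P i.K) 0 (SU N) → (((ζ.pinReg ρ g).withSectE E).famLG i).Cfg) {O₁ O₂ e₅ : ℝ}
    (hbg14 : ∀ (i : ZIdx) (ε : ℝ) (V : GaugeField (F.P i.K) i.k (SU N)) (U : GaugeField (F.P i.K) 0 (SU N)),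
      InUkClassB11 F N i.K i.k (ζ.C₁ * ζ.B₃ * ε) U → Averaging.iter (avOfRecord F N i.K) i.k U = V →
        (((ζ.pinReg ρ g).withSectE E).famLG i).Sat14 (ζ.C₁ * ζ.B₃ * ε) (ζ.C₁ * ε) ((βr i).bdry V) (bg i U))
    (gaugeFix : ∀ (i : ZIdx) (ε₀ ε₁ : ℝ) (V : GaugeField (F.P i.K) i.k (SU N)) (U₀ : (((ζ.pinReg ρ g).withSectE E).famLG i).Cfg)
      (U : GaugeField (F.P i.K) 0 (SU N)),
      (((ζ.pinReg ρ g).withSectE E).famLG i).Sat14 (ζ.C₁ * ζ.B₃ * ε₁) (ζ.C₁ * ε₁) ((βr i).bdry V) U₀ → InUkClassB11 F N i.K i.k ε₀ U →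
        Averaging.iter (avOfRecord F N i.K) i.k U = V →
          ∃ U' : (((ζ.pinReg ρ g).withSectE E).famLG i).Pert, (((ζ.pinReg ρ g).withSectE E).famLG i).In18 ε₀ ((βr i).bdry V) U₀ U' ∧
            OrbitRel i.k U ((βr i).emb U₀ U') ∧ (IsCritOfRecord F N i.K i.k V U → (((ζ.pinReg ρ g).withSectE E).famLG i).Crit ((βr i).bdry V) U₀ U'))
    (orbit16 : ∀ (i : ZIdx) (U₀ : (((ζ.pinReg ρ g).withSectE E).famLG i).Cfg) (U₁ : (((ζ.pinReg ρ g).withSectE E).famLG i).Pert)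
      (u u' : (((ζ.pinReg ρ g).withSectE E).famLG i).GT),
      (((ζ.pinReg ρ g).withSectE E).famLG i).Restricted U₀ u → (((ζ.pinReg ρ g).withSectE E).famLG i).Restricted U₀ u' →
        OrbitRel i.k ((βr i).emb U₀ ((((ζ.pinReg ρ g).withSectE E).famLG i).toAxial U₀ U₁ u))
          ((βr i).emb U₀ ((((ζ.pinReg ρ g).withSectE E).famLG i).toAxial U₀ U₁ u')))
    (leaves : ∀ i, ExistenceLeavesCap (βr i) ζ.B₀ ζ.B₃ ζ.C₁ O₁ O₂ e₅)
    (hB₀ : 0 < ζ.B₀) (hB₁ : 0 < ζ.B₁) (hB₃ : 1 ≤ ζ.B₃) (hC₁L : (F.L : ℝ) ^ 3 ≤ ζ.C₁) (hB₀B₁ : ζ.B₀ ≤ 4 * ζ.B₁)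
    (hc₁ : 0 < ζ.c₁) (hO₁ : 0 < O₁) (hO₂ : 0 < O₂) (he₅ : 0 < e₅)
    (p2 : B11.Prop2Printed ζ.B₁ ζ.B₃ ζ.C₁ ζ.c₁ ((ζ.pinReg ρ g).withSectE E).famLG)
    (p3 : B11.Prop3Printed ζ.C₁ ζ.B₃ ζ.C₂ ζ.C₃ ζ.B₀ ζ.c1h ζ.c₄ ζ.δ₀ ((ζ.pinReg ρ g).withSectE E).famLG)
    (p5 : B11.Prop5Printed ζ.B₁ ζ.B₃ ζ.C₁ ((ζ.pinReg ρ g).withSectE E).famLG)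
    (p8 : B11.Prop8Printed ζ.B₃ (famXOfRecord F N ((ζ.pinReg ρ g).withSectEG E G).pinCrit))
    (sF : B11.SectFPrinted ζ.B₃ (famXOfRecord F N ((ζ.pinReg ρ g).withSectEG E G).pinCrit)) :
    ∃ C : B11Thm1.Consts, ∀ (i : ZIdx) (ε₁ : ℝ), 0 < ε₁ → ε₁ ≤ C.a₁ → ∀ V : GaugeField (F.P i.K) i.k (SU N), PlaqSmall ε₁ V →
      ∀ U : GaugeField (F.P i.K) 0 (SU N), IsBackground (avOfRecord F N i.K) {U | InUkClassB11 F N i.K i.k (C.B₃ * ε₁) U} i.k V U →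
        ∀ q : (g i).Q, (g i).sizeM q ≤ C.Mfun ε₁ →
          Reg910T F N i.K i.k U ((g i).carrier q) ((g i).scale q) (g i).dist (C.B₃ * (g i).sizeM q * ε₁) (C.B₄ * (g i).sizeM q * ε₁) 1 :=
  reg910T_of_b11Leaf_pinReg
    (ζ := (ζ.withSectEG (⟨E.C₄, E.a₃, E.α, E.D, E.R⟩ : SectEPres F N L η β ζ) (⟨G.q, G.valid, G.hC₁, G.hβ₀, G.hδ₀, G.hB₅, G.D⟩ : SectGPres F N 𝒴 𝒵 ζ)).pinCrit) hρ
    (b11Leaf_Z11OfRecord_fullyPinned_of_towerT_parts_kappa_one ζ ρ g E G hC₄ ha₃ hα βr bg hbg14 gaugeFix orbit16 leaves hB₀ hB₁ hB₃ hC₁L hB₀B₁ hc₁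
      hO₁ hO₂ he₅ p2 p3 p5 p8 sF)

/-! ## §4 Census in kernel: the Sect.-F slot is junk-closable through the cube class (empty carriers) -/

/-- ★ **CENSUS — THE DISPLAYED `sF` IS JUNK-CLOSABLE THROUGH THE CUBE CLASS** (referee ref-G READ37 (w6) ∕ READ39 REMARK (i), READER RULE v0.38, in kernel): if every cube of every class
`g i` has EMPTY carrier (and positive size parameter), then at ζ⋆ the hypothesis `B11.SectFPrinted B₃ (famXOfRecord …)` HOLDS OUTRIGHT for every `B₃ > 0` — at an empty carrier the pin
says «gauged with optimal constant 0» (def-B11's `regularity_regPinT_of_carrier_empty`), so every cube's (9)–(10) clause is met whatever `U` is.  Hence a COUNT line over ζ⋆ must display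
NON-EMPTY carriers or read `g` from print's cubes («□ ⊂ B_j(Λ_j) ∪ B_{j+1}(Λ_{j+1})», p. 279); the closers above are count-neutral as filed. [cite: Balaban1985Variational, Sect. F (169) p.305, Thm 1 (9)–(10) p.279 (bookkeeping: the cube class is data)] -/
theorem sectFPrinted_fullyPinned_of_carrier_empty {B₃ : ℝ} (hB₃ : 0 < B₃)
    (hempty : ∀ (i : ZIdx) (q : (g i).Q), (g i).carrier q = ∅) (hM : ∀ (i : ZIdx) (q : (g i).Q), 0 < (g i).sizeM q) :
    B11.SectFPrinted B₃ (famXOfRecord F N ((ζ.pinReg ρ g).withSectEG E G).pinCrit) := by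
  refine ⟨1, 1, 1, one_pos, one_pos, one_pos, fun i ε₁ V U hε₁ _ _ _ _ _ q _ => ?_⟩
  exact regularity_regPinT_of_carrier_empty (hempty i q) (mul_pos (mul_pos hB₃ (hM i q)) hε₁) (mul_pos (mul_pos one_pos (hM i q)) hε₁) U

end Summit.QuantumFields.YangMills.BalabanUVNodes.N07AtRecordFullyPinned

end
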